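import Summits.AtomisticToContinuum.HydrodynamicLimit.Theorems.AntiMazurCoboundariesCellForecastPressureDecayClusterTailCharging
import Summits.AtomisticToContinuum.HydrodynamicLimit.Theorems.AntiMazurCoboundariesCellForecastPressureDecayClusterTailInsertion
import Summits.AtomisticToContinuum.HydrodynamicLimit.Theorems.AntiMazurCoboundariesCellForecastPressureDecayContactLayerBounds
import HarnessLib

/-!
# S2e(D) · the short-time cluster tail, piece 4: double cylinders are second order (static)
# (registered sub-goal `stub_clusterTail_doubleCylinder` of stub `stub_clusterTail`, crux line
# `enskog-compensator-martingale`, crux `CellForecastPressureDecay`, stmt-AtomisticToContinuum-13915)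

Under the canonical cell law `P_{n,L}` (`n ≤ 2L³` spheres of diameter `σ ≤ 3/16` in `[0,L]³`, `L ≥ 1`), the expected
number of ordered triples of distinct labels `(p, q, k)` such that the initial relative data of BOTH pairs `(p, q)` and
`(p, k)` lie in Boltzmann's collision cylinder of the slab `(0, Δ]` is `≤ C L³ Δ² ≤ C (L³Δ² + L²Δ)`:

* `InCylinder.symm`, `InCylinder.pairHits` — the cylinder event of a pair in the jointly measurable hitting-time form
  of piece S2e(B) (`exists_cylinder_iff_pairHits`), for the relative data `(x_q − x_p, v_q − v_p)`;
* `posLaw_tripleEvent_le` — Ruelle's three-label bound (`posLaw_le_two_pow_mul_pi`, factor `2³`) followed by the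
  integration of the two outer labels against independent uniform points (`pi_cube_tripleEvent_le`):
  `posLaw{x_i − x_j ∈ T, x_k − x_j ∈ T'} ≤ 8 · vol(T)/L³ · vol(T')/L³`;
* `cellLaw_doubleRel_le` — disintegration of the cell law along `(pos, vel)_* P_{n,L} = posLaw ⊗ γ^{⊗n}`
  (`CellLawFactorises`, `lintegral_cellLaw_eq`): for a measurable relation `R ⊆ ℝ³ × ℝ³` whose sections have volume
  `≤ a‖u‖`, the event `{(x_q − x_p, v_q − v_p) ∈ R, (x_k − x_p, v_k − v_p) ∈ R}` has probability
  `≤ 8 a² L⁻⁶ E‖v_q − v_p‖‖v_k − v_p‖ ≤ 96 a² L⁻⁶` (Gaussian second moments `E‖v‖² = 3`);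
* `stub_clusterTail_doubleCylinder` — summing over the `n³ ≤ 8L⁹` triples with `a = σ²Δ|S²|`
  (`volume_cylRel_section_le`): `C = 768 (σ²|S²|)²`.

References: D. Ruelle, *Statistical Mechanics: Rigorous Results* (1969), §4.2; C. Cercignani, R. Illner,
M. Pulvirenti, *The Mathematical Theory of Dilute Gases* (1994), §2.2 and §4.4 (collision cylinders, the
Boltzmann–Grad estimate of recollision/double-cylinder events).
-/

noncomputable section

open MeasureTheory ProbabilityTheory Set Filter Topology
open scoped ENNReal BigOperators InnerProductSpace
open Literature.Analysis.FluidPDE Literature.MathematicalPhysics.KineticTheory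
open Literature.MathematicalPhysics.StatisticalMechanics
open Summit.AtomisticToContinuum.HydrodynamicLimit.Theorems.CellForecastPressureDecay
  (cellCube measurableSet_cellCube volume_cellCube)

namespace Summit.AtomisticToContinuum.HydrodynamicLimit.Theorems.EnskogCompensator

/-! ## § 1 The cylinder event of a pair in hitting-time form -/

/-- The collision cylinder of the slab is symmetric in the two labels (`ω ↦ −ω`). [folklore] -/
theorem InCylinder.symm {σ Δ : ℝ} {n : ℕ} {z : Cell n} {i j : Fin n} (h : InCylinder σ Δ z i j) :
    InCylinder σ Δ z j i := by
  obtain ⟨ω, t, ht, hω, heq⟩ := h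
  refine ⟨-ω, t, ht, ?_, ?_⟩
  · rw [coe_neg_sphere, inner_neg_left, ← inner_neg_right, neg_sub]
    exact hω
  · rw [coe_neg_sphere, ← neg_sub (z i).1, heq, ← neg_sub (z i).2, smul_neg, smul_neg]
    abel

/-- **The cylinder event in hitting-time form**: if the initial data of `(i, j)` lie in the collision cylinder of
the slab `(0, Δ]`, then the free pair `(x_j − x_i, v_j − v_i)` hits transversally with first hitting time in
`(0, Δ]` (`exists_cylinder_iff_pairHits` of piece S2e(B)). [cite: CIP1994, §2.2] -/
theorem InCylinder.pairHits {σ Δ : ℝ} (hσ : 0 < σ) {n : ℕ} {z : Cell n} {i j : Fin n}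
    (h : InCylinder σ Δ z i j) :
    PairHits σ ((z j).1 - (z i).1) ((z j).2 - (z i).2) ∧ 0 < pairDisc σ ((z j).1 - (z i).1) ((z j).2 - (z i).2) ∧
      pairHitTime σ ((z j).1 - (z i).1) ((z j).2 - (z i).2) ∈ Ioc 0 Δ :=
  (exists_cylinder_iff_pairHits hσ Δ _ _).1 h.symm

/-! ## § 2 Static three-label bounds -/

/-- **Ruelle's three-label bound, integrated**: for `0 < σ ≤ 3/16`, `L ≥ 1`, `n ≤ 2L³`, distinct labels `i, j, k`
and measurable `T, T' ⊆ ℝ³`, `posLaw{x_i − x_j ∈ T, x_k − x_j ∈ T'} ≤ 2³ · (vol T / L³) · (vol T' / L³)` — the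
uniform hard-core law is dominated on three-label events by `8 ×` the law of independent uniform points
(`posLaw_le_two_pow_mul_pi`), under which the outer labels are integrated one at a time
(`pi_cube_tripleEvent_le`). [cite: Ruelle1969, §4.2] -/
theorem posLaw_tripleEvent_le {σ L : ℝ} (hσ : 0 < σ) (hσ' : σ ≤ 3 / 16) (hL : 1 ≤ L) {n : ℕ}
    (hn : (n : ℝ) ≤ 2 * L ^ 3) {i j k : Fin n} (hij : i ≠ j) (hjk : j ≠ k) (hik : i ≠ k) {T T' : Set V3}
    (hT : MeasurableSet T) (hT' : MeasurableSet T') :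
    posLaw σ L n {x | x i - x j ∈ T ∧ x k - x j ∈ T'} ≤
      8 * (ENNReal.ofReal ((L ^ 3)⁻¹) * volume T * (ENNReal.ofReal ((L ^ 3)⁻¹) * volume T')) := by
  have hL0 : 0 < L := one_pos.trans_le hL
  haveI := isProbabilityMeasure_cond_cellCube hL0
  have hE : MeasurableSet {x : Fin n → V3 | x i - x j ∈ T ∧ x k - x j ∈ T'} :=
    (measurableSet_pairEvent_cell i j hT).inter (measurableSet_pairEvent_cell k j hT')
  have hcard : ({i, j, k} : Finset (Fin n)).card = 3 := by
    rw [Finset.card_insert_of_notMem (by simp [hij, hik]), Finset.card_pair hjk]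
  calc posLaw σ L n {x | x i - x j ∈ T ∧ x k - x j ∈ T'}
      ≤ 2 ^ ({i, j, k} : Finset (Fin n)).card *
          Measure.pi (fun _ : Fin n => volume[|cellCube L]) {x | x i - x j ∈ T ∧ x k - x j ∈ T'} :=
        posLaw_le_two_pow_mul_pi hσ hσ' hL hn {i, j, k} hE fun x y hxy => by
          simp only [Set.mem_setOf_eq, hxy i (by simp), hxy j (by simp), hxy k (by simp)]
    _ ≤ 2 ^ ({i, j, k} : Finset (Fin n)).card *
          ((volume (cellCube L))⁻¹ * volume T * ((volume (cellCube L))⁻¹ * volume T')) := by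
        gcongr
        exact pi_cube_tripleEvent_le hL0 hij hjk hik hT hT'
    _ = 8 * (ENNReal.ofReal ((L ^ 3)⁻¹) * volume T * (ENNReal.ofReal ((L ^ 3)⁻¹) * volume T')) := by
        rw [hcard, inv_volume_cellCube hL0]
        norm_num

/-- `‖b − a‖ ‖c − a‖ ≤ 2‖a‖² + ‖b‖² + ‖c‖²`. [folklore] -/
theorem norm_sub_mul_norm_sub_le (a b c : V3) : ‖b - a‖ * ‖c - a‖ ≤ 2 * ‖a‖ ^ 2 + ‖b‖ ^ 2 + ‖c‖ ^ 2 := by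
  have h1 : ‖b - a‖ ≤ ‖b‖ + ‖a‖ := norm_sub_le b a
  have h2 : ‖c - a‖ ≤ ‖c‖ + ‖a‖ := norm_sub_le c a
  have h3 : ‖b - a‖ * ‖c - a‖ ≤ (‖b‖ + ‖a‖) * (‖c‖ + ‖a‖) := mul_le_mul h1 h2 (norm_nonneg _) (by positivity)
  nlinarith [sq_nonneg (‖a‖ - ‖b‖), sq_nonneg (‖a‖ - ‖c‖), sq_nonneg (‖b‖ - ‖c‖)]

/-! ## § 3 Gaussian second moments of the velocities -/

/-- `∫ ‖v_e‖² dγ^{⊗n}(v) = 3` (the marginal of one velocity is the standard Maxwellian on `ℝ³`). [folklore] -/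
theorem lintegral_norm_sq_eval_pi_stdGaussian {n : ℕ} (e : Fin n) :
    ∫⁻ v, ENNReal.ofReal (‖v e‖ ^ 2) ∂(Measure.pi fun _ : Fin n => stdGaussian V3) = 3 := by
  have hmp := measurePreserving_eval (fun _ : Fin n => stdGaussian V3) e
  have hg : Measurable fun w : V3 => ENNReal.ofReal (‖w‖ ^ 2) := (measurable_norm.pow_const 2).ennreal_ofReal
  have h3 : ∫⁻ v, ENNReal.ofReal (‖v e‖ ^ 2) ∂(Measure.pi fun _ : Fin n => stdGaussian V3) =
      ∫⁻ w, ENNReal.ofReal (‖w‖ ^ 2) ∂stdGaussian V3 := MeasurePreserving.lintegral_comp hmp hg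
  rw [h3, ← ofReal_integral_eq_lintegral_ofReal integrable_norm_sq_stdGaussian
    (Eventually.of_forall fun w => sq_nonneg _), integral_norm_sq_stdGaussian]
  simp

/-- `∫ (2‖v_p‖² + ‖v_q‖² + ‖v_k‖²) dγ^{⊗n}(v) = 12`. [folklore] -/
theorem lintegral_velWeight_pi_stdGaussian {n : ℕ} (p q k : Fin n) :
    ∫⁻ v, (2 * ENNReal.ofReal (‖v p‖ ^ 2) + ENNReal.ofReal (‖v q‖ ^ 2) + ENNReal.ofReal (‖v k‖ ^ 2))
      ∂(Measure.pi fun _ : Fin n => stdGaussian V3) = 12 := by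
  have hf : ∀ e : Fin n, Measurable fun v : Fin n → V3 => ENNReal.ofReal (‖v e‖ ^ 2) := fun e =>
    ((measurable_pi_apply e).norm.pow_const 2).ennreal_ofReal
  have h12 : Measurable fun v : Fin n → V3 => 2 * ENNReal.ofReal (‖v p‖ ^ 2) + ENNReal.ofReal (‖v q‖ ^ 2) :=
    ((hf p).const_mul 2).add (hf q)
  have h2 : Measurable fun v : Fin n → V3 => 2 * ENNReal.ofReal (‖v p‖ ^ 2) := (hf p).const_mul 2
  rw [lintegral_add_left h12, lintegral_add_left h2, lintegral_const_mul _ (hf p),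
    lintegral_norm_sq_eval_pi_stdGaussian, lintegral_norm_sq_eval_pi_stdGaussian,
    lintegral_norm_sq_eval_pi_stdGaussian]
  norm_num

/-! ## § 4 A double relation at one sphere under the cell law -/

/-- **Two relations at one sphere are second order.** For `0 < σ ≤ 3/16`, `L ≥ 1`, `n ≤ 2L³`, a measurable relation
`R ⊆ ℝ³ × ℝ³` of (relative position, relative velocity) whose sections have volume `vol{d | (d, u) ∈ R} ≤ a‖u‖`,
and distinct labels `p, q, k`: the event that both `(x_q − x_p, v_q − v_p)` and `(x_k − x_p, v_k − v_p)` lie in `R`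
has `P_{n,L}`-probability `≤ 96 (a / L³)²` — disintegration `(pos, vel)_* P_{n,L} = posLaw ⊗ γ^{⊗n}`, the
three-label bound `8 (a‖v_q − v_p‖/L³)(a‖v_k − v_p‖/L³)` at fixed velocities, and the Gaussian moment
`E‖v_q − v_p‖‖v_k − v_p‖ ≤ E(2‖v_p‖² + ‖v_q‖² + ‖v_k‖²) = 12`. [cite: CIP1994, §4.4] -/
theorem cellLaw_doubleRel_le {σ L : ℝ} (hσ : 0 < σ) (hσ' : σ ≤ 3 / 16) (hfac : CellLawFactorises σ) (hL : 1 ≤ L)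
    {n : ℕ} (hn : (n : ℝ) ≤ 2 * L ^ 3) (Ψ : Flows σ) {R : Set (V3 × V3)} (hR : MeasurableSet R) {a : ℝ}
    (ha : 0 ≤ a) (hvol : ∀ u : V3, volume {d : V3 | (d, u) ∈ R} ≤ ENNReal.ofReal (a * ‖u‖)) {p q k : Fin n}
    (hqp : q ≠ p) (hpk : p ≠ k) (hqk : q ≠ k) :
    cellLaw σ L n Ψ {z | ((z q).1 - (z p).1, (z q).2 - (z p).2) ∈ R ∧ ((z k).1 - (z p).1, (z k).2 - (z p).2) ∈ R} ≤
      ENNReal.ofReal (96 * ((L ^ 3)⁻¹ * a) ^ 2) := by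
  have hL0 : 0 < L := one_pos.trans_le hL
  haveI := isProbabilityMeasure_posLaw (posZ_ne_zero hσ' hL hn)
  set E : Set (Cell n) :=
    {z | ((z q).1 - (z p).1, (z q).2 - (z p).2) ∈ R ∧ ((z k).1 - (z p).1, (z k).2 - (z p).2) ∈ R} with hE
  have hEm : MeasurableSet E :=
    (hR.preimage (by fun_prop : Measurable fun z : Cell n => ((z q).1 - (z p).1, (z q).2 - (z p).2))).inter
      (hR.preimage (by fun_prop : Measurable fun z : Cell n => ((z k).1 - (z p).1, (z k).2 - (z p).2)))
  have hK0 : 0 ≤ 8 * ((L ^ 3)⁻¹ * a) ^ 2 := by positivity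
  -- the position integral at fixed velocities
  have hinner : ∀ v : Fin n → V3, ∫⁻ x, E.indicator 1 (fun c => (x c, v c)) ∂posLaw σ L n ≤
      ENNReal.ofReal (8 * ((L ^ 3)⁻¹ * a) ^ 2 * (‖v q - v p‖ * ‖v k - v p‖)) := by
    intro v
    have hA : MeasurableSet {d : V3 | (d, v q - v p) ∈ R} := hR.preimage (by fun_prop)
    have hB : MeasurableSet {d : V3 | (d, v k - v p) ∈ R} := hR.preimage (by fun_prop)
    have hEv : MeasurableSet {x : Fin n → V3 | x q - x p ∈ {d : V3 | (d, v q - v p) ∈ R} ∧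
        x k - x p ∈ {d : V3 | (d, v k - v p) ∈ R}} :=
      (measurableSet_pairEvent_cell q p hA).inter (measurableSet_pairEvent_cell k p hB)
    change ∫⁻ x, {x : Fin n → V3 | x q - x p ∈ {d : V3 | (d, v q - v p) ∈ R} ∧
        x k - x p ∈ {d : V3 | (d, v k - v p) ∈ R}}.indicator 1 x ∂posLaw σ L n ≤ _
    rw [lintegral_indicator_one hEv]
    calc posLaw σ L n {x : Fin n → V3 | x q - x p ∈ {d : V3 | (d, v q - v p) ∈ R} ∧
          x k - x p ∈ {d : V3 | (d, v k - v p) ∈ R}}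
        ≤ 8 * (ENNReal.ofReal ((L ^ 3)⁻¹) * volume {d : V3 | (d, v q - v p) ∈ R} *
            (ENNReal.ofReal ((L ^ 3)⁻¹) * volume {d : V3 | (d, v k - v p) ∈ R})) :=
          posLaw_tripleEvent_le hσ hσ' hL hn hqp hpk hqk hA hB
      _ ≤ 8 * (ENNReal.ofReal ((L ^ 3)⁻¹) * ENNReal.ofReal (a * ‖v q - v p‖) *
            (ENNReal.ofReal ((L ^ 3)⁻¹) * ENNReal.ofReal (a * ‖v k - v p‖))) := by
          gcongr
          · exact hvol _
          · exact hvol _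
      _ = ENNReal.ofReal (8 * ((L ^ 3)⁻¹ * (a * ‖v q - v p‖) * ((L ^ 3)⁻¹ * (a * ‖v k - v p‖)))) := by
          simp (disch := positivity) only [ENNReal.ofReal_mul, ENNReal.ofReal_ofNat]
      _ = ENNReal.ofReal (8 * ((L ^ 3)⁻¹ * a) ^ 2 * (‖v q - v p‖ * ‖v k - v p‖)) := by
          congr 1
          ring
  -- the velocity weight is measurable
  have hf : ∀ e : Fin n, Measurable fun v : Fin n → V3 => ENNReal.ofReal (‖v e‖ ^ 2) := fun e =>
    ((measurable_pi_apply e).norm.pow_const 2).ennreal_ofReal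
  have hW : Measurable fun v : Fin n → V3 =>
      2 * ENNReal.ofReal (‖v p‖ ^ 2) + ENNReal.ofReal (‖v q‖ ^ 2) + ENNReal.ofReal (‖v k‖ ^ 2) :=
    (((hf p).const_mul 2).add (hf q)).add (hf k)
  calc cellLaw σ L n Ψ E = ∫⁻ z, E.indicator 1 z ∂cellLaw σ L n Ψ := (lintegral_indicator_one hEm).symm
    _ = ∫⁻ v, ∫⁻ x, E.indicator 1 (fun c => (x c, v c)) ∂posLaw σ L n ∂(Measure.pi fun _ : Fin n => stdGaussian V3) :=
        lintegral_cellLaw_eq hfac L n Ψ (measurable_one.indicator hEm)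
    _ ≤ ∫⁻ v, ENNReal.ofReal (8 * ((L ^ 3)⁻¹ * a) ^ 2 * (‖v q - v p‖ * ‖v k - v p‖))
          ∂(Measure.pi fun _ : Fin n => stdGaussian V3) := lintegral_mono hinner
    _ ≤ ∫⁻ v, ENNReal.ofReal (8 * ((L ^ 3)⁻¹ * a) ^ 2) *
          (2 * ENNReal.ofReal (‖v p‖ ^ 2) + ENNReal.ofReal (‖v q‖ ^ 2) + ENNReal.ofReal (‖v k‖ ^ 2))
          ∂(Measure.pi fun _ : Fin n => stdGaussian V3) := by
        refine lintegral_mono fun v => ?_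
        calc ENNReal.ofReal (8 * ((L ^ 3)⁻¹ * a) ^ 2 * (‖v q - v p‖ * ‖v k - v p‖))
            ≤ ENNReal.ofReal (8 * ((L ^ 3)⁻¹ * a) ^ 2 * (2 * ‖v p‖ ^ 2 + ‖v q‖ ^ 2 + ‖v k‖ ^ 2)) :=
              ENNReal.ofReal_le_ofReal (mul_le_mul_of_nonneg_left (norm_sub_mul_norm_sub_le _ _ _) hK0)
          _ = _ := by
              simp (disch := positivity) only [ENNReal.ofReal_mul, ENNReal.ofReal_add, ENNReal.ofReal_ofNat]
    _ = ENNReal.ofReal (8 * ((L ^ 3)⁻¹ * a) ^ 2) * 12 := by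
        rw [lintegral_const_mul _ hW, lintegral_velWeight_pi_stdGaussian]
    _ = ENNReal.ofReal (96 * ((L ^ 3)⁻¹ * a) ^ 2) := by
        rw [← ENNReal.ofReal_ofNat 12, ← ENNReal.ofReal_mul hK0]
        congr 1
        ring

/-! ## § 5 The registered sub-goal -/

open Classical in
/-- **Registered sub-goal `stub_clusterTail_doubleCylinder`** (S2e-4, piece of stub `stub_clusterTail` of the line
`enskog-compensator-martingale`): **double cylinders are second order (static).** For `0 < σ ≤ 3/16` and the
factorised cell law there is `C = 768 (σ²|S²|)²` such that for `L ≥ 1`, `n ≤ 2L³`, every cluster dynamics and every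
slab `Δ ∈ (0, 1]`, the expected number of ordered triples of distinct labels `(p, q, k)` with the initial data of
both `(p, q)` and `(p, k)` in the collision cylinder of the slab is `≤ C (L³Δ² + L²Δ)`: each triple costs
`≤ 96 (σ²Δ|S²| / L³)²` (Ruelle's three-label bound, cylinder sections of volume `≤ σ²Δ‖u‖|S²|`, Gaussian moments),
and there are `n³ ≤ 8L⁹` of them. [cite: CIP1994, §4.4] -/
theorem stub_clusterTail_doubleCylinder : ∀ σ : ℝ, 0 < σ → σ ≤ 3 / 16 → CellLawFactorises σ →
    ∃ C : ℝ, 0 ≤ C ∧ ∀ L : ℝ, 1 ≤ L → ∀ n : ℕ, (n : ℝ) ≤ 2 * L ^ 3 → ∀ (Ψ : Flows σ) (Δ : ℝ), 0 < Δ → Δ ≤ 1 →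
      ∫⁻ z, ((Finset.univ.filter fun t : Fin n × Fin n × Fin n => t.1 ≠ t.2.1 ∧ t.1 ≠ t.2.2 ∧ t.2.1 ≠ t.2.2 ∧
          InCylinder σ Δ z t.1 t.2.1 ∧ InCylinder σ Δ z t.1 t.2.2).card : ℝ≥0∞)
          ∂(cellLaw σ L n Ψ) ≤ ENNReal.ofReal (C * (L ^ 3 * Δ ^ 2 + L ^ 2 * Δ)) := by
  intro σ hσ hσ' hfac
  set s : ℝ := (sphereMeasure (Set.univ : Set (Metric.sphere (0 : V3) 1))).toReal with hs
  have hs0 : 0 ≤ s := ENNReal.toReal_nonneg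
  refine ⟨768 * (σ ^ 2 * s) ^ 2, by positivity, fun L hL n hn Ψ Δ hΔ _ => ?_⟩
  have hL0 : 0 < L := one_pos.trans_le hL
  have hStop : sphereMeasure (Set.univ : Set (Metric.sphere (0 : V3) 1)) ≠ ⊤ := measure_ne_top _ _
  -- the cylinder relation of the slab and the volume of its sections
  set R : Set (V3 × V3) :=
    {c | PairHits σ c.1 c.2 ∧ 0 < pairDisc σ c.1 c.2 ∧ pairHitTime σ c.1 c.2 ∈ Ioc 0 Δ} with hR
  have hRm : MeasurableSet R := measurableSet_cylRel σ Δ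
  have hvol : ∀ u : V3, volume {d : V3 | (d, u) ∈ R} ≤ ENNReal.ofReal (σ ^ 2 * Δ * s * ‖u‖) := fun u => by
    calc volume {d : V3 | (d, u) ∈ R}
        ≤ ENNReal.ofReal (σ ^ 2 * Δ * ‖u‖) * sphereMeasure (Set.univ : Set (Metric.sphere (0 : V3) 1)) :=
          volume_cylRel_section_le hσ Δ u
      _ = ENNReal.ofReal (σ ^ 2 * Δ * s * ‖u‖) := by
          rw [← ENNReal.ofReal_toReal hStop, ← ENNReal.ofReal_mul (by positivity)]
          congr 1
          rw [hs]
          ring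
  -- the event of a triple and its measurable majorant
  have hEm : ∀ t : Fin n × Fin n × Fin n, MeasurableSet {z : Cell n |
      ((z t.2.1).1 - (z t.1).1, (z t.2.1).2 - (z t.1).2) ∈ R ∧ ((z t.2.2).1 - (z t.1).1, (z t.2.2).2 - (z t.1).2) ∈ R} :=
    fun t => (hRm.preimage (by fun_prop : Measurable fun z : Cell n =>
        ((z t.2.1).1 - (z t.1).1, (z t.2.1).2 - (z t.1).2))).inter
      (hRm.preimage (by fun_prop : Measurable fun z : Cell n => ((z t.2.2).1 - (z t.1).1, (z t.2.2).2 - (z t.1).2)))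
  have hterm : ∀ t : Fin n × Fin n × Fin n, t.1 ≠ t.2.1 → t.1 ≠ t.2.2 → t.2.1 ≠ t.2.2 →
      cellLaw σ L n Ψ {z : Cell n | ((z t.2.1).1 - (z t.1).1, (z t.2.1).2 - (z t.1).2) ∈ R ∧
        ((z t.2.2).1 - (z t.1).1, (z t.2.2).2 - (z t.1).2) ∈ R} ≤
        ENNReal.ofReal (96 * ((L ^ 3)⁻¹ * (σ ^ 2 * Δ * s)) ^ 2) :=
    fun t h1 h2 h3 => cellLaw_doubleRel_le hσ hσ' hfac hL hn Ψ hRm (by positivity) hvol h1.symm h2 h3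
  set G : Fin n × Fin n × Fin n → Cell n → ℝ≥0∞ := fun t z =>
    if t.1 ≠ t.2.1 ∧ t.1 ≠ t.2.2 ∧ t.2.1 ≠ t.2.2 then
      {z : Cell n | ((z t.2.1).1 - (z t.1).1, (z t.2.1).2 - (z t.1).2) ∈ R ∧
        ((z t.2.2).1 - (z t.1).1, (z t.2.2).2 - (z t.1).2) ∈ R}.indicator 1 z
    else 0 with hG
  have hGm : ∀ t, Measurable (G t) := fun t => by
    by_cases ht : t.1 ≠ t.2.1 ∧ t.1 ≠ t.2.2 ∧ t.2.1 ≠ t.2.2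
    · simp only [hG, if_pos ht]
      exact measurable_one.indicator (hEm t)
    · simp only [hG, if_neg ht]
      exact measurable_const
  have hGle : ∀ t, ∫⁻ z, G t z ∂cellLaw σ L n Ψ ≤ ENNReal.ofReal (96 * ((L ^ 3)⁻¹ * (σ ^ 2 * Δ * s)) ^ 2) := by
    intro t
    by_cases ht : t.1 ≠ t.2.1 ∧ t.1 ≠ t.2.2 ∧ t.2.1 ≠ t.2.2
    · simp only [hG, if_pos ht]
      rw [lintegral_indicator_one (hEm t)]
      exact hterm t ht.1 ht.2.1 ht.2.2
    · simp only [hG, if_neg ht, lintegral_const, zero_mul, zero_le]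
  -- the count is dominated by the majorant
  have hpt : ∀ z : Cell n, ((Finset.univ.filter fun t : Fin n × Fin n × Fin n => t.1 ≠ t.2.1 ∧ t.1 ≠ t.2.2 ∧
      t.2.1 ≠ t.2.2 ∧ InCylinder σ Δ z t.1 t.2.1 ∧ InCylinder σ Δ z t.1 t.2.2).card : ℝ≥0∞) ≤ ∑ t, G t z := by
    intro z
    rw [Finset.natCast_card_filter]
    refine Finset.sum_le_sum fun t _ => ?_
    split_ifs with h
    · obtain ⟨h1, h2, h3, hpq, hpk⟩ := h
      have hz : z ∈ {z : Cell n | ((z t.2.1).1 - (z t.1).1, (z t.2.1).2 - (z t.1).2) ∈ R ∧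
          ((z t.2.2).1 - (z t.1).1, (z t.2.2).2 - (z t.1).2) ∈ R} := ⟨hpq.pairHits hσ, hpk.pairHits hσ⟩
      simp only [hG, if_pos (⟨h1, h2, h3⟩ : t.1 ≠ t.2.1 ∧ t.1 ≠ t.2.2 ∧ t.2.1 ≠ t.2.2), indicator_of_mem hz,
        Pi.one_apply, le_refl]
    · simp
  -- assemble
  refine (lintegral_mono hpt).trans ?_
  rw [lintegral_finsetSum _ fun t _ => hGm t]
  refine (Finset.sum_le_sum fun t _ => hGle t).trans ?_
  rw [Finset.sum_const, Finset.card_univ, Fintype.card_prod, Fintype.card_prod, Fintype.card_fin, nsmul_eq_mul,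
    ← ENNReal.ofReal_natCast, ← ENNReal.ofReal_mul (Nat.cast_nonneg _)]
  refine ENNReal.ofReal_le_ofReal ?_
  push_cast
  have h1 : (n : ℝ) ^ 3 ≤ (2 * L ^ 3) ^ 3 := pow_le_pow_left₀ (Nat.cast_nonneg n) hn 3
  have hL3 : L ^ 3 ≠ 0 := (pow_pos hL0 3).ne'
  have key : (n : ℝ) ^ 3 * ((L ^ 3)⁻¹) ^ 2 ≤ 8 * L ^ 3 := by
    calc (n : ℝ) ^ 3 * ((L ^ 3)⁻¹) ^ 2 ≤ (2 * L ^ 3) ^ 3 * ((L ^ 3)⁻¹) ^ 2 :=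
          mul_le_mul_of_nonneg_right h1 (sq_nonneg _)
      _ = 8 * L ^ 3 * (L ^ 3 * (L ^ 3)⁻¹) ^ 2 := by ring
      _ = 8 * L ^ 3 := by rw [mul_inv_cancel₀ hL3, one_pow, mul_one]
  have hA : 0 ≤ 96 * (σ ^ 2 * Δ * s) ^ 2 := by positivity
  have hB : 0 ≤ 768 * (σ ^ 2 * s) ^ 2 * (L ^ 2 * Δ) := by positivity
  calc (n : ℝ) * ((n : ℝ) * (n : ℝ)) * (96 * ((L ^ 3)⁻¹ * (σ ^ 2 * Δ * s)) ^ 2)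
      = (96 * (σ ^ 2 * Δ * s) ^ 2) * ((n : ℝ) ^ 3 * ((L ^ 3)⁻¹) ^ 2) := by ring
    _ ≤ (96 * (σ ^ 2 * Δ * s) ^ 2) * (8 * L ^ 3) := mul_le_mul_of_nonneg_left key hA
    _ ≤ (96 * (σ ^ 2 * Δ * s) ^ 2) * (8 * L ^ 3) + 768 * (σ ^ 2 * s) ^ 2 * (L ^ 2 * Δ) :=
        le_add_of_nonneg_right hB
    _ = 768 * (σ ^ 2 * s) ^ 2 * (L ^ 3 * Δ ^ 2 + L ^ 2 * Δ) := by ring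

end Summit.AtomisticToContinuum.HydrodynamicLimit.Theorems.EnskogCompensator

end
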